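import Mathlib
import Summits.QuantumAdvantage.QuantumAdvantage.Theorems.MobiusLadderQuadraticDigitPhasesStubDwdOfWords

/-!
# LOW-cut Kátai from an abstract rank functional: the assembly (`stub_rankAsm`)

Stub `stub_rankAsm` of the crux `MobiusLadder.QuadraticDigitPhases` (stmt-QuantumAdvantage-1391),
line `Sketch`: the bookkeeping that turns

* `hBlock` — an aligned dyadic block sum (length `2^N`) of the Kátai product phase is bounded by the
  `ℓ¹` quantity `L1(p, q, n, N, P)`,
* `hCore` — for distinct odd primes `p, q`, a cut bound `R₀` and `δ > 0` there are `s, r` such that,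
  for every `s' ≥ s`, an `s'`-separated set `B` of readers `< N` of rank `rk ≥ r` forces `L1 ≤ δ 2^N`,
* the four axioms of the abstract rank functional `rk n P s B N`: `hDickson` (not `(R, s)`-low ⇒
  `2R ≤ rk (range n)`), `hSplit` (sub-additivity over the residue classes mod `m`), `hTrunc`
  (truncating the columns at `N` loses at most `#{b ∈ B | N ≤ b} + R₀`) and `hRkLe` (`rk ≤ #B`),

into the LOW-cut Kátai bound `|Σ_{m ≤ M} F_p(m) F_q(m)| ≤ τ M` for `2^n ≤ 2BM`, `M ≤ 2^n`.

Parameters (given `B, τ, R₀`): `δ = τ/(16B)`, `2^L > 16B/τ`; for every pair in `range (B+1)²`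
thresholds `(s_pq, r_pq)` from `hCore` (`choose` + `Finset.sup`), `S = sup s_pq`, `G = sup r_pq`,
`R = (S+1)(G + L + R₀ + 1)`, `s = S`.  For fixed `n, P, p, q, M`: `hDickson` and `hSplit` (classes
mod `S+1`, which are `S`-separated) give a class `B_c ⊆ range n` with `rk(B_c, n) > G + L + R₀`;
by `hRkLe` it has more than `L` elements, so `L < n`; for a block level `i ≥ i₀ = n - L`, `hTrunc`
at `N = i` loses at most `(n - i) + R₀ ≤ L + R₀`, so `rk(B_c ∩ [0,i), i) > G ≥ r_pq` and `hCore`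
gives `L1 ≤ δ 2^i`; shorter blocks cost `≤ 2^i`, and the dyadic cover
`…StubDwdOfWords.abs_sum_Ico_le_cover` gives `|Σ_{Ico 1 M}| ≤ 2 (2^{i₀} + 2 δ 2^n) ≤ τM/4 + τM/2`;
the last term `m = M` costs `1 < τM/8`.
-/

set_option linter.dupNamespace false -- D-0017: single-problem summit ⇒ `QuantumAdvantage.QuantumAdvantage` by design

namespace Summit.QuantumAdvantage.QuantumAdvantage.Theorems.MobiusLadderQuadraticDigitPhasesStubRankAsm

open Finset

/-- ASSEMBLY of the LOW-cut Kátai bound in ABSTRACT form (registered stub `stub_rankAsm` of crux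
stmt-QuantumAdvantage-1391, line Sketch): `F n P p m` is the phase (only `|F| ≤ 1` is used),
`L1 n P p q N` the `ℓ¹` state quantity, `cut n P R₀` the cut-rank bound, `low n P R s` the `(R, s)`-low
property and `rk n P s B N` an abstract rank functional satisfying `hDickson`, `hSplit`, `hTrunc`, `hRkLe`.
From the block bound `hBlock` and the rank core `hCore` we get the LOW-cut Kátai bound with
`R = (S+1)(G + L + R₀ + 1)`, `s = S` (see the module docstring for the computation). -/
theorem stub_rankAsm :
    ∀ (F : (n : ℕ) → MvPolynomial (Fin n) (ZMod 2) → ℕ → ℕ → ℝ)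
      (L1 : (n : ℕ) → MvPolynomial (Fin n) (ZMod 2) → ℕ → ℕ → ℕ → ℝ)
      (cut : (n : ℕ) → MvPolynomial (Fin n) (ZMod 2) → ℕ → Prop)
      (low : (n : ℕ) → MvPolynomial (Fin n) (ZMod 2) → ℕ → ℕ → Prop)
      (rk : (n : ℕ) → MvPolynomial (Fin n) (ZMod 2) → ℕ → Finset ℕ → ℕ → ℕ),
    (∀ n P p m, |F n P p m| ≤ 1) →
    (∀ (p q n N : ℕ) (P : MvPolynomial (Fin n) (ZMod 2)), P.totalDegree ≤ 2 → N ≤ n → 0 < p → 0 < q → ∀ mhi : ℕ,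
      |∑ T ∈ Finset.range (2 ^ N), F n P p (mhi * 2 ^ N + T) * F n P q (mhi * 2 ^ N + T)| ≤ L1 n P p q N) →
    (∀ p q : ℕ, p.Prime → q.Prime → p ≠ q → 2 < p → 2 < q → ∀ R₀ : ℕ, ∀ δ : ℝ, 0 < δ → ∃ s r : ℕ, ∀ s' : ℕ, s ≤ s' →
      ∀ (n N : ℕ) (P : MvPolynomial (Fin n) (ZMod 2)), N ≤ n → cut n P R₀ →
      (∃ B : Finset ℕ, (∀ b ∈ B, b < N) ∧ (∀ b ∈ B, ∀ b' ∈ B, b < b' → s' < b' - b) ∧ r ≤ rk n P s' B N) →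
      L1 n P p q N ≤ δ * (2 : ℝ) ^ N) →
    (∀ (n : ℕ) (P : MvPolynomial (Fin n) (ZMod 2)) (R s : ℕ), P.totalDegree ≤ 2 → ¬ low n P R s →
      2 * R ≤ rk n P s (Finset.range n) n) →
    (∀ (n : ℕ) (P : MvPolynomial (Fin n) (ZMod 2)) (s : ℕ) (B : Finset ℕ) (N m : ℕ), 0 < m →
      rk n P s B N ≤ ∑ c ∈ Finset.range m, rk n P s (B.filter (fun b => b % m = c)) N) →
    (∀ (n : ℕ) (P : MvPolynomial (Fin n) (ZMod 2)) (s R₀ : ℕ) (B : Finset ℕ) (N : ℕ), N ≤ n → cut n P R₀ →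
      (∀ b ∈ B, ∀ b' ∈ B, b < b' → s < b' - b) →
      rk n P s B n ≤ rk n P s (B.filter (fun b => b < N)) N + (B.filter (fun b => N ≤ b)).card + R₀) →
    (∀ (n : ℕ) (P : MvPolynomial (Fin n) (ZMod 2)) (s : ℕ) (B : Finset ℕ) (N : ℕ), rk n P s B N ≤ B.card) →
    ∀ B : ℕ, ∀ τ : ℝ, 0 < τ → ∀ R₀ : ℕ, ∃ R s : ℕ, ∀ n : ℕ, ∀ P : MvPolynomial (Fin n) (ZMod 2),
      P.totalDegree ≤ 2 → cut n P R₀ → ¬ low n P R s →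
      ∀ p q : ℕ, p.Prime → q.Prime → p ≠ q → 2 < p → 2 < q → p ≤ B → q ≤ B →
      ∀ M : ℕ, M ≤ 2 ^ n → 2 ^ n ≤ 2 * B * M →
        |∑ m ∈ Finset.Icc 1 M, F n P p m * F n P q m| ≤ τ * M := by
  intro F L1 cut low rk hF1 hBlock hCore hDickson hSplit hTrunc hRkLe B τ hτ R₀
  classical
  rcases Nat.eq_zero_or_pos B with rfl | hB
  · exact ⟨0, 0, fun n P _ _ _ p q hp _ _ hp2 _ hpB => absurd hpB (by omega)⟩
  have hBr : (0 : ℝ) < B := by exact_mod_cast hB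
  set δ : ℝ := τ / (16 * B) with hδ
  have hδpos : 0 < δ := by positivity
  obtain ⟨L, hL⟩ := pow_unbounded_of_one_lt (16 * (B : ℝ) / τ) (one_lt_two (α := ℝ))
  -- one pair of thresholds `(s, r)` for every admissible pair of primes
  have hpair : ∀ pq : ℕ × ℕ, ∃ sr : ℕ × ℕ,
      (pq.1.Prime ∧ pq.2.Prime ∧ pq.1 ≠ pq.2 ∧ 2 < pq.1 ∧ 2 < pq.2) →
      ∀ s' : ℕ, sr.1 ≤ s' → ∀ (n N : ℕ) (P : MvPolynomial (Fin n) (ZMod 2)), N ≤ n → cut n P R₀ →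
      (∃ B : Finset ℕ, (∀ b ∈ B, b < N) ∧ (∀ b ∈ B, ∀ b' ∈ B, b < b' → s' < b' - b) ∧
        sr.2 ≤ rk n P s' B N) → L1 n P pq.1 pq.2 N ≤ δ * (2 : ℝ) ^ N := by
    rintro ⟨p, q⟩
    by_cases h : p.Prime ∧ q.Prime ∧ p ≠ q ∧ 2 < p ∧ 2 < q
    · obtain ⟨s, r, hsr⟩ := hCore p q h.1 h.2.1 h.2.2.1 h.2.2.2.1 h.2.2.2.2 R₀ δ hδpos
      exact ⟨(s, r), fun _ => hsr⟩
    · exact ⟨(0, 0), fun h' => absurd h' h⟩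
  choose sr hsr using hpair
  obtain ⟨S, hSall⟩ : ∃ S : ℕ, ∀ pq ∈ range (B + 1) ×ˢ range (B + 1), (sr pq).1 ≤ S :=
    ⟨(range (B + 1) ×ˢ range (B + 1)).sup (fun pq => (sr pq).1),
      fun pq hpq => Finset.le_sup (f := fun pq => (sr pq).1) hpq⟩
  obtain ⟨G, hGall⟩ : ∃ G : ℕ, ∀ pq ∈ range (B + 1) ×ˢ range (B + 1), (sr pq).2 ≤ G :=
    ⟨(range (B + 1) ×ˢ range (B + 1)).sup (fun pq => (sr pq).2),
      fun pq hpq => Finset.le_sup (f := fun pq => (sr pq).2) hpq⟩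
  refine ⟨(S + 1) * (G + L + R₀ + 1), S, ?_⟩
  intro n P hP hcut hnot p q hp hq hne hp2 hq2 hpB hqB M hM hBM
  have hmem : (p, q) ∈ range (B + 1) ×ˢ range (B + 1) := by
    simp only [Finset.mem_product, Finset.mem_range]; omega
  have hs0 := hSall (p, q) hmem
  have hg0 := hGall (p, q) hmem
  -- a residue class mod `S + 1` of large rank: it is `S`-separated
  obtain ⟨Bc, hBcsub, hsep, hrk⟩ : ∃ Bc : Finset ℕ, Bc ⊆ range n ∧
      (∀ b ∈ Bc, ∀ b' ∈ Bc, b < b' → S < b' - b) ∧ G + L + R₀ < rk n P S Bc n := by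
    obtain ⟨c, -, hc⟩ : ∃ c ∈ range (S + 1),
        G + L + R₀ < rk n P S ((range n).filter (fun b => b % (S + 1) = c)) n := by
      apply Finset.exists_lt_of_sum_lt
      rw [Finset.sum_const, Finset.card_range, smul_eq_mul]
      calc (S + 1) * (G + L + R₀) < (S + 1) * (G + L + R₀ + 1) :=
            Nat.mul_lt_mul_of_pos_left (Nat.lt_succ_self _) (Nat.succ_pos _)
        _ ≤ 2 * ((S + 1) * (G + L + R₀ + 1)) := Nat.le_mul_of_pos_left _ (by norm_num)
        _ ≤ _ := (hDickson n P _ S hP hnot).trans (hSplit n P S (range n) n (S + 1) (Nat.succ_pos S))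
    refine ⟨_, Finset.filter_subset _ _, fun b hb b' hb' hbb' => ?_, hc⟩
    rw [Finset.mem_filter] at hb hb'
    have h1 : (b' - b) % (S + 1) = 0 := Nat.sub_mod_eq_zero_of_mod_eq (by rw [hb'.2, hb.2])
    have h2 : S + 1 ≤ b' - b := Nat.le_of_dvd (by omega) (Nat.dvd_of_mod_eq_zero h1)
    omega
  -- `n` is large: the class has more than `L` elements below `n`
  have hLn : L < n := by
    have h1 := hRkLe n P S Bc n
    have h2 : Bc.card ≤ n := (Finset.card_le_card hBcsub).trans (Finset.card_range n).le
    omega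
  set i₀ : ℕ := n - L with hi₀
  set f : ℕ → ℝ := fun m => F n P p m * F n P q m with hf
  have hf1 : ∀ m, |f m| ≤ 1 := fun m => by
    simp only [hf, abs_mul]
    exact mul_le_one₀ (hF1 n P p m) (abs_nonneg _) (hF1 n P q m)
  -- aligned dyadic blocks: trivially `≤ 2^i`, and `≤ δ 2^i` from level `i₀` on
  have hKey : ∀ i x, i ≤ n → |∑ T ∈ Ico (x * 2 ^ i) ((x + 1) * 2 ^ i), f T| ≤
      (if i < i₀ then (2 : ℝ) ^ i else 0) + δ * 2 ^ i := by
    intro i x hi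
    rw [Finset.sum_Ico_eq_sum_range, show (x + 1) * 2 ^ i - x * 2 ^ i = 2 ^ i by
      rw [add_mul, one_mul, Nat.add_sub_cancel_left]]
    by_cases hii : i < i₀
    · rw [if_pos hii]
      calc _ ≤ ∑ T ∈ range (2 ^ i), |f (x * 2 ^ i + T)| := Finset.abs_sum_le_sum_abs _ _
        _ ≤ ∑ T ∈ range (2 ^ i), (1 : ℝ) := Finset.sum_le_sum fun T _ => hf1 _
        _ = (2 : ℝ) ^ i := by simp
        _ ≤ _ := le_add_of_nonneg_right (by positivity)
    · rw [if_neg hii, zero_add]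
      -- truncate the columns at `i`: at most `(n - i) + R₀ ≤ L + R₀` of the rank is lost
      have hT := hTrunc n P S R₀ Bc i hi hcut hsep
      have hcard : (Bc.filter (fun b => i ≤ b)).card ≤ L := by
        calc (Bc.filter (fun b => i ≤ b)).card ≤ (Finset.Ico i n).card := by
              refine Finset.card_le_card fun b hb => ?_
              rw [Finset.mem_filter] at hb
              have hbn := Finset.mem_range.mp (hBcsub hb.1)
              rw [Finset.mem_Ico]
              exact ⟨hb.2, hbn⟩
          _ = n - i := Nat.card_Ico i n
          _ ≤ L := by omega
      have hBlk : ∃ B' : Finset ℕ, (∀ b ∈ B', b < i) ∧ (∀ b ∈ B', ∀ b' ∈ B', b < b' → S < b' - b) ∧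
          (sr (p, q)).2 ≤ rk n P S B' i := by
        refine ⟨Bc.filter (fun b => b < i), fun b hb => (Finset.mem_filter.mp hb).2,
          fun b hb b' hb' hbb' => hsep b (Finset.mem_filter.mp hb).1 b' (Finset.mem_filter.mp hb').1 hbb',
          ?_⟩
        omega
      exact (hBlock p q n i P hP hi hp.pos hq.pos x).trans
        (hsr (p, q) ⟨hp, hq, hne, hp2, hq2⟩ S hs0 n i P hi hcut hBlk)
  -- the dyadic cover
  have hcov : ∀ b' : ℕ, b' ≤ 2 ^ n → |∑ T ∈ Ico 1 b', f T| ≤ 2 * (2 ^ i₀ + 2 * δ * 2 ^ n) := by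
    intro b' hb'
    have h := MobiusLadderQuadraticDigitPhasesStubDwdOfWords.abs_sum_Ico_le_cover _ n f hKey 1 b' hb'
    rw [Finset.sum_add_distrib] at h
    have hsum1 : ∑ i ∈ range (n + 1), (if i < i₀ then (2 : ℝ) ^ i else 0) ≤ 2 ^ i₀ := by
      rw [← Finset.sum_filter, show (range (n + 1)).filter (· < i₀) = range i₀ by
        ext j; simp only [Finset.mem_filter, Finset.mem_range]; omega,
        MobiusLadderQuadraticDigitPhasesStubDwdOfWords.sum_two_pow]
      linarith
    have hsum2 : ∑ i ∈ range (n + 1), δ * (2 : ℝ) ^ i ≤ 2 * δ * 2 ^ n := by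
      rw [← Finset.mul_sum, MobiusLadderQuadraticDigitPhasesStubDwdOfWords.sum_two_pow, pow_succ]
      nlinarith
    linarith
  -- split off the last term and conclude
  have hM1 : 1 ≤ M := by
    rcases Nat.eq_zero_or_pos M with rfl | h
    · rw [mul_zero] at hBM
      exact absurd hBM (Nat.pos_iff_ne_zero.mp (Nat.two_pow_pos n) ∘ Nat.le_zero.mp)
    · exact h
  rw [← Finset.Ico_insert_right hM1, Finset.sum_insert Finset.right_notMem_Ico]
  have hXY : (2 : ℝ) ^ i₀ * 2 ^ L = 2 ^ n := by
    rw [← pow_add]; congr 1; omega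
  have hBM' : (2 : ℝ) ^ n ≤ 2 * B * M := by exact_mod_cast hBM
  have h16 : 16 * (B : ℝ) < τ * 2 ^ L := by
    have := (div_lt_iff₀ hτ).mp hL; linarith
  have hLn' : (2 : ℝ) ^ L ≤ 2 ^ n := pow_le_pow_right₀ one_le_two hLn.le
  have ha : 16 * (B : ℝ) * 2 ^ i₀ < τ * (2 * B * M) := by
    calc 16 * (B : ℝ) * 2 ^ i₀ < τ * 2 ^ L * 2 ^ i₀ := by gcongr
      _ = τ * 2 ^ n := by rw [mul_assoc, mul_comm ((2 : ℝ) ^ L), hXY]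
      _ ≤ τ * (2 * B * M) := by gcongr
  have ha' : 16 * (2 : ℝ) ^ i₀ < τ * (2 * M) :=
    lt_of_mul_lt_mul_left (a := (B : ℝ)) (by linarith) hBr.le
  have hb : δ * (2 : ℝ) ^ n ≤ τ * M / 8 := by
    calc δ * (2 : ℝ) ^ n ≤ δ * (2 * B * M) := by gcongr
      _ = τ * M / 8 := by rw [hδ]; field_simp; ring
  have hc : 16 * (B : ℝ) < τ * (2 * B * M) := by nlinarith
  have hc' : (16 : ℝ) < τ * (2 * M) := lt_of_mul_lt_mul_left (a := (B : ℝ)) (by linarith) hBr.le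
  calc |f M + ∑ T ∈ Ico 1 M, f T| ≤ |f M| + |∑ T ∈ Ico 1 M, f T| := abs_add_le _ _
    _ ≤ 1 + 2 * (2 ^ i₀ + 2 * δ * 2 ^ n) := add_le_add (hf1 M) (hcov M hM)
    _ ≤ τ * M := by linarith

end Summit.QuantumAdvantage.QuantumAdvantage.Theorems.MobiusLadderQuadraticDigitPhasesStubRankAsm
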